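import Summits.CriticalPhenomena.PercolationContinuityZ3.Theorems.Transplant.SkelFrmFrom1FaceHoldsQ3VNode
import Summits.CriticalPhenomena.PercolationContinuityZ3.Theorems.Transplant.SkelFrmFromBChoiceSlotCongrPx
import Summits.CriticalPhenomena.PercolationContinuityZ3.Theorems.Transplant.SkelFrmFromBChoiceDefsVPx
import Summits.CriticalPhenomena.PercolationContinuityZ3.Theorems.Transplant.SkelFrmFromBParamsKitBump
import Summits.CriticalPhenomena.PercolationContinuityZ3.Theorems.Transplant.SkelFrmFromBFaceHoldsQ3VOfPx
import HarnessLib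

/-!
# U_s execution (RULING D-Us / Us-R10, lead g22 2026-08-27; WAVE-Us-MANIFEST v1.0 §3/§5): «SkelFrmFrom1FaceHoldsQ3VNodePx» — **THE GEN (F) COLUMN TOP, ∀ D,
# AT THE TUPLE Px OF RECORD UNDER PROXIES** — `PlanarSkeletonFrmFrom.NegB.faceHoldsRNQFnLTKPxAt_frmChoiceAllQ3VPx_node (D Kmin) (hKmin : 480 ≤ Kmin) :
# FaceHoldsRNQFnLTKPxAt LfQ (fun x => x ^ 3) Kmin (frmChoiceAllQ3VPx D (gvPx D) (fvPx D) (PvPx D) (SUS (exPx D) (mxPx D)) (cvPx D) (hvPx D) BSlot.small3)` — the (F)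
# obligation the U_s node reads BY NAME (1 of 4; p465608's shape `hF := fun D => … D 480 (by norm_num)`)

builds on p205010 (kernel theorem, internal audit signed; external expert review pending) — nothing in this file uses p205010; NOTHING is claimed about the
OPEN node U_s `SamePDropOfSkeletonFrmScaled₁` until the node file lands.  Lane `prim-bschramm`, seat `prim-bschramm-gen-1` gen 2 (GEN pen, (F)-top pen by RULING
Us-R10); helper file (`--supports stmt-CriticalPhenomena-4575 --as helper`); GEN column top (NEW TEXT in the U top «SkelFrmFrom1FaceHoldsQ3VNode»'s shape; PROOFS ONLY).
§1 THE JUNCTION AT `(O, q)` (proofs only): the choice data of record read EVERY slot only through its value at `O.merged` (`gOf/fOf/cOf/hOf/bOf`, `SMnP … Pv`,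
`schedOfT … (Sv … O.merged …)`), so at `(O, q)` ALL SEVEN tuple slots may be replaced by the U constructors AT THE RAISED INDEX `m′ := KS.RK t O.merged 0 + D`
(«SkelFrmFromBChoiceSlotsPx» `…Px_at`, rfl): `atQ3V_tupleAllPx_iff` (premises; box/width by p3's `atQ3V_tuplePx_iff`, pairs by `atQ3V_congrP`, fibre/cells ignored
by `AtQNQ`), `scheme_tupleAllPx_eq` / `FD_tupleAllPx_eq` (scheme and face data; box/width by p3's `scheme/FD_tuplePx_eq`, fibre block and cells by
`scheme/FD_congrSCH`, pairs dropped by `scheme/FD_congrP`; `SUS_tuplePx_at` is the fibre block's value at `O.merged`, rfl).  §2 THE TOP `faceHoldsRNQFnLTKPxAt_frmChoiceAllQ3VPx_node`: after `intro … O q hAt` the Px data's `hAt` gives `AtQNQ` of `choiceAtQ3V` (`atQ3V_of_atQ3VPx`) and the four width floors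
`D ≤ k / nKit 0 / n_L / nBF m′` + the raised-index row `RK 0 + D ≤ RK m′` («…DefsVPx» §2/§5, «…KitBump» §4); §1 moves `hAt` and the goal to the fixed-index U
shapes at `m′`; the FIVE NODE ROWS are the U top's text read at `m′` (`uA_oth_factsR0`, `cR2vW_le_r_oth/_apply/_caps`, `hFV_le`, `hFRv_apply`, `small3_eq`,
`bwX_eq/bwY_eq`, `T0_lt_R'0`, `faceNodeRows_arith_le`); the face obligation is then the (F) column's layer (a7) under proxies
(«SkelFrmFromBFaceHoldsQ3VOfPx», stmt-g29) at `(mk, mkP, cW) := (0, m′, cF κ)` with the U floor lemmas AT `m′` for every record (`le_gxQ/le_fxQ ….2.1`,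
`exF2_le_exQ`, `mF_le_mxF`, `subset_PR_PxQ ….2.1`) and U's `hLf`/`hc600` arithmetic (`LfQ_eq`, `cF_eq`).
[cite: KozmaNitzan2024, §4 Lemma 12 (pp. 23–25), Theorem 6 (pp. 25–31)] [cite: BenjaminiSchramm1996, Conj. 4] [this work]
-/

noncomputable section

open scoped Classical ENNReal

namespace Summit.CriticalPhenomena.PercolationContinuityZ3.Theorems.Transplant

namespace PlanarSkeletonFrmFrom

namespace NegB

open MeasureTheory Literature.Probability.Percolation Literature.Probability.LatticeModels SimpleGraph KNCells KNLevels GadgetSystem Contour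
open Literature.Probability.Percolation.KozmaNitzan
open Literature.Probability.Percolation.KozmaNitzan.Cells (oth sgOf sgOf_sign stepVec_apply_fst)
open Literature.Barriers.CriticalPhenomena (graphBall mem_graphBall_self graphBall_mono)
open BoxProdZ2 (ConcRadiiG Erad Frad nQ nS)
open ChainPlanar ChainPara
open Skel (winGraph routeW excess WinStepData)
open SkelI (tanOff)
open TwoAxis.Para (modulus detD rep₂)
open SkelConc (Consts)
open Skelφ
open Skelφ.StepI (DataNS OutNS)
open Neg

/-! ## §1 The junction at `(O, q)`: all seven tuple slots ↦ the U constructors at the raised index (proofs only) -/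

section Junction

variable {κ : Consts} {V : Type} [DecidableEq V] [Countable V] {G : SimpleGraph V} [G.LocallyFinite] {Φ : PlanarSkeletonFrmFrom G} {t : V} {p : unitInterval}
  {hC : Φ.CylSubcritical p} {Pv Pv₁ Pv₂ : PSlot} {gv fv : Neg.FSlot} {Sv Sv₁ Sv₂ : SSlot} {cv cv₁ cv₂ hv hv₁ hv₂ : CSlot} {bv : BSlot} {O : OutNS V} {q : unitInterval}

/-- The scheme of the Px choice data at `(O, q)` is the scheme of `choiceAtQ3V` (by `rfl`: only the seed floor `m₀` differs). [folklore] -/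
theorem choiceAtQ3VPx_scheme_eq (D : ℕ) :
    (choiceAtQ3VPx κ Φ t p D Pv gv fv Sv cv hv bv hC).scheme O q = (choiceAtQ3V κ Φ t p Pv gv fv Sv cv hv bv hC).scheme O q := rfl

/-- The face data of the Px choice data at `(O, q)` are the face data of `choiceAtQ3V` (by `rfl`). [folklore] -/
theorem choiceAtQ3VPx_FD_eq (D : ℕ) :
    (choiceAtQ3VPx κ Φ t p D Pv gv fv Sv cv hv bv hC).FD O q = (choiceAtQ3V κ Φ t p Pv gv fv Sv cv hv bv hC).FD O q := rfl

/-- **`AtQNQ` congruence in the pair slot**: pair slots agreeing at `O.merged` give the same premises (`AtQNQ` reads `Pv` only through `SMnP … O.merged … Pv`).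
[this work] -/
theorem atQ3V_congrP (hP : Pv₁ κ Φ t p O.merged = Pv₂ κ Φ t p O.merged) :
    (choiceAtQ3V κ Φ t p Pv₁ gv fv Sv cv hv bv hC).AtQNQ O q ↔ (choiceAtQ3V κ Φ t p Pv₂ gv fv Sv cv hv bv hC).AtQNQ O q := by
  have hS : (choiceAtQ3V κ Φ t p Pv₁ gv fv Sv cv hv bv hC).SMn O = (choiceAtQ3V κ Φ t p Pv₂ gv fv Sv cv hv bv hC).SMn O := by
    show SMnP κ Φ t p O.merged (gOf κ Φ t p O gv) (fOf κ Φ t p O fv) Pv₁ = SMnP κ Φ t p O.merged (gOf κ Φ t p O gv) (fOf κ Φ t p O fv) Pv₂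
    unfold SMnP; rw [hP]
  unfold ChoiceNQ.AtQNQ
  rw [hS]
  exact Iff.rfl

/-- **`AtQNQ` ignores the fibre, creep and room slots** (gen-1's `atQ3V_cells`, restated for the four slots this file swaps). [folklore] -/
theorem atQ3V_congrSCH :
    (choiceAtQ3V κ Φ t p Pv gv fv Sv₁ cv₁ hv₁ bv hC).AtQNQ O q ↔ (choiceAtQ3V κ Φ t p Pv gv fv Sv₂ cv₂ hv₂ bv hC).AtQNQ O q :=
  ⟨fun h => ⟨h.1, h.2.1, h.2.2.1, h.2.2.2.1, h.2.2.2.2⟩, fun h => ⟨h.1, h.2.1, h.2.2.1, h.2.2.2.1, h.2.2.2.2⟩⟩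

/-- **Scheme congruence in the fibre, creep and room slots**: slots agreeing at `O.merged` give the same scheme at `(O, q)` (`ΓQV` reads `Sv` through
`schedOfT … (Sv … O.merged (gOf) (fOf) q)`, `cv/hv` through `cOf/hOf`). [this work] -/
theorem scheme_congrSCH (hS : ∀ (g f : ℕ) (q' : unitInterval), Sv₁ κ Φ t p O.merged g f q' = Sv₂ κ Φ t p O.merged g f q')
    (hc : ∀ g f : ℕ, cv₁ κ Φ t p O.merged g f = cv₂ κ Φ t p O.merged g f) (hh : ∀ g f : ℕ, hv₁ κ Φ t p O.merged g f = hv₂ κ Φ t p O.merged g f) :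
    (choiceAtQ3V κ Φ t p Pv gv fv Sv₁ cv₁ hv₁ bv hC).scheme O q = (choiceAtQ3V κ Φ t p Pv gv fv Sv₂ cv₂ hv₂ bv hC).scheme O q := by
  have ec : cOf κ Φ t p O gv fv cv₁ = cOf κ Φ t p O gv fv cv₂ := hc _ _
  have eh : hOf κ Φ t p O gv fv hv₁ = hOf κ Φ t p O gv fv hv₂ := hh _ _
  rw [choiceAtQ3V_scheme, choiceAtQ3V_scheme]
  unfold ΓQV
  rw [ec, eh, hS]

/-- **Face-data congruence in the fibre, creep and room slots.** [this work] -/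
theorem FD_congrSCH (hS : ∀ (g f : ℕ) (q' : unitInterval), Sv₁ κ Φ t p O.merged g f q' = Sv₂ κ Φ t p O.merged g f q')
    (hc : ∀ g f : ℕ, cv₁ κ Φ t p O.merged g f = cv₂ κ Φ t p O.merged g f) (hh : ∀ g f : ℕ, hv₁ κ Φ t p O.merged g f = hv₂ κ Φ t p O.merged g f) :
    (choiceAtQ3V κ Φ t p Pv gv fv Sv₁ cv₁ hv₁ bv hC).FD O q = (choiceAtQ3V κ Φ t p Pv gv fv Sv₂ cv₂ hv₂ bv hC).FD O q := by
  have ec : cOf κ Φ t p O gv fv cv₁ = cOf κ Φ t p O gv fv cv₂ := hc _ _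
  have eh : hOf κ Φ t p O gv fv hv₁ = hOf κ Φ t p O gv fv hv₂ := hh _ _
  rw [choiceAtQ3V_FD, choiceAtQ3V_FD]
  unfold FDQV
  rw [ec, eh, hS]

/-- **The scheme does not read the pair slot** (`Pv` enters `SMn` only). [folklore] -/
theorem scheme_congrP : (choiceAtQ3V κ Φ t p Pv₁ gv fv Sv cv hv bv hC).scheme O q = (choiceAtQ3V κ Φ t p Pv₂ gv fv Sv cv hv bv hC).scheme O q := by
  rw [choiceAtQ3V_scheme, choiceAtQ3V_scheme]

/-- **The face data do not read the pair slot.** [folklore] -/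
theorem FD_congrP : (choiceAtQ3V κ Φ t p Pv₁ gv fv Sv cv hv bv hC).FD O q = (choiceAtQ3V κ Φ t p Pv₂ gv fv Sv cv hv bv hC).FD O q := by
  rw [choiceAtQ3V_FD, choiceAtQ3V_FD]

/-- The tuple's fibre block at `O.merged` is the U fibre block at the raised index (by `rfl`, `exPx_at`/`mxPx_at`). [folklore] -/
theorem SUS_tuplePx_at (D g f : ℕ) (q' : unitInterval) :
    SUS (exPx D) (mxPx D) κ Φ t p O.merged g f q' =
      SUS (exQ (KS.RK t O.merged 0 + D) (exRD (KS.RK t O.merged 0 + D) D)) (mxQ (mxF (KS.RK t O.merged 0 + D))) κ Φ t p O.merged g f q' := rfl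

/-- **`AtQNQ` AT THE TUPLE Px OF RECORD ⇔ `AtQNQ` AT THE SEVEN U CONSTRUCTORS OF THE RAISED INDEX `m′ := KS.RK t O.merged 0 + D`.** [this work] -/
theorem atQ3V_tupleAllPx_iff (D : ℕ) :
    (choiceAtQ3V κ Φ t p (PvPx D) (gvPx D) (fvPx D) (SUS (exPx D) (mxPx D)) (cvPx D) (hvPx D) bv hC).AtQNQ O q ↔
      (choiceAtQ3V κ Φ t p (KS.PR (KS.RK t O.merged 0 + D) (PxQ (KS.RK t O.merged 0 + D) (PxR (KS.RK t O.merged 0 + D))))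
        (KS.gT (KS.RK t O.merged 0 + D) (gxQ (KS.RK t O.merged 0 + D) (gxR0 (KS.RK t O.merged 0 + D)) (fxR (KS.RK t O.merged 0 + D)))) (KS.fT (KS.RK t O.merged 0 + D) (fxQ (KS.RK t O.merged 0 + D) (fxR (KS.RK t O.merged 0 + D))))
        (SUS (exQ (KS.RK t O.merged 0 + D) (exRD (KS.RK t O.merged 0 + D) D)) (mxQ (mxF (KS.RK t O.merged 0 + D)))) (cR2W (KS.RK t O.merged 0 + D)) (hFR (KS.RK t O.merged 0 + D)) bv hC).AtQNQ O q :=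
  (atQ3V_tuplePx_iff D).trans ((atQ3V_congrP (PvPx_at κ Φ t p O.merged D)).trans atQ3V_congrSCH)

/-- **THE SCHEME AT THE TUPLE = THE SCHEME AT THE SEVEN U CONSTRUCTORS OF THE RAISED INDEX.** [this work] -/
theorem scheme_tupleAllPx_eq (D : ℕ) :
    (choiceAtQ3V κ Φ t p (PvPx D) (gvPx D) (fvPx D) (SUS (exPx D) (mxPx D)) (cvPx D) (hvPx D) bv hC).scheme O q =
      (choiceAtQ3V κ Φ t p (KS.PR (KS.RK t O.merged 0 + D) (PxQ (KS.RK t O.merged 0 + D) (PxR (KS.RK t O.merged 0 + D))))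
        (KS.gT (KS.RK t O.merged 0 + D) (gxQ (KS.RK t O.merged 0 + D) (gxR0 (KS.RK t O.merged 0 + D)) (fxR (KS.RK t O.merged 0 + D)))) (KS.fT (KS.RK t O.merged 0 + D) (fxQ (KS.RK t O.merged 0 + D) (fxR (KS.RK t O.merged 0 + D))))
        (SUS (exQ (KS.RK t O.merged 0 + D) (exRD (KS.RK t O.merged 0 + D) D)) (mxQ (mxF (KS.RK t O.merged 0 + D)))) (cR2W (KS.RK t O.merged 0 + D)) (hFR (KS.RK t O.merged 0 + D)) bv hC).scheme O q := by
  exact ((scheme_tuplePx_eq D).trans (scheme_congrSCH (bv := bv) (hC := hC) (q := q) (fun g f q' => SUS_tuplePx_at D g f q')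
    (fun g f => funext fun i => cvPx_at κ Φ t p O.merged D g f i) (fun g f => funext fun i => hvPx_at κ Φ t p O.merged D g f i))).trans scheme_congrP

/-- **THE FACE DATA AT THE TUPLE = THE FACE DATA AT THE SEVEN U CONSTRUCTORS OF THE RAISED INDEX.** [this work] -/
theorem FD_tupleAllPx_eq (D : ℕ) :
    (choiceAtQ3V κ Φ t p (PvPx D) (gvPx D) (fvPx D) (SUS (exPx D) (mxPx D)) (cvPx D) (hvPx D) bv hC).FD O q =
      (choiceAtQ3V κ Φ t p (KS.PR (KS.RK t O.merged 0 + D) (PxQ (KS.RK t O.merged 0 + D) (PxR (KS.RK t O.merged 0 + D))))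
        (KS.gT (KS.RK t O.merged 0 + D) (gxQ (KS.RK t O.merged 0 + D) (gxR0 (KS.RK t O.merged 0 + D)) (fxR (KS.RK t O.merged 0 + D)))) (KS.fT (KS.RK t O.merged 0 + D) (fxQ (KS.RK t O.merged 0 + D) (fxR (KS.RK t O.merged 0 + D))))
        (SUS (exQ (KS.RK t O.merged 0 + D) (exRD (KS.RK t O.merged 0 + D) D)) (mxQ (mxF (KS.RK t O.merged 0 + D)))) (cR2W (KS.RK t O.merged 0 + D)) (hFR (KS.RK t O.merged 0 + D)) bv hC).FD O q := by
  exact ((FD_tuplePx_eq D).trans (FD_congrSCH (bv := bv) (hC := hC) (q := q) (fun g f q' => SUS_tuplePx_at D g f q')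
    (fun g f => funext fun i => cvPx_at κ Φ t p O.merged D g f i) (fun g f => funext fun i => hvPx_at κ Φ t p O.merged D g f i))).trans FD_congrP

end Junction

/-! ## §2 The (F) column top at the tuple, ∀ D -/

set_option maxHeartbeats 1600000 in
/-- **THE GEN (F) COLUMN PROP, ∀ D, AT THE TUPLE OF RECORD UNDER PROXIES** (TUPLE Px OF RECORD, «SkelFrmFromBChoiceSlotsPx»): for every proxy radius `D` and every
`Kmin ≥ 480`, `FaceHoldsRNQFnLTKPxAt LfQ (fun x => x ^ 3) Kmin (frmChoiceAllQ3VPx D (gvPx D) (fvPx D) (PvPx D) (SUS (exPx D) (mxPx D)) (cvPx D) (hvPx D) BSlot.small3)` —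
the U (F) top's node rows at the raised kit index `KS.RK t O.merged 0 + D` over the (F) column's layer (a7) under proxies (see the module docstring).
[cite: KozmaNitzan2024, §4 Lemma 12 (pp. 23–25), Theorem 6 (pp. 25–31)] -/
theorem faceHoldsRNQFnLTKPxAt_frmChoiceAllQ3VPx_node (D Kmin : ℕ) (hKmin : 480 ≤ Kmin) :
    FaceHoldsRNQFnLTKPxAt LfQ (fun x => x ^ 3) Kmin
      (frmChoiceAllQ3VPx D (gvPx D) (fvPx D) (PvPx D) (SUS (exPx D) (mxPx D)) (cvPx D) (hvPx D) BSlot.small3) := by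
  intro κ V _ _ G _ Φ hg t ht hP p hp0 hp1 hC hK hFl hCF O q hAt
  rw [frmChoiceAllQ3VPx_eq] at hAt
  -- the width floors and the raised-index row from the Px data («…DefsVPx» §2/§5, «…KitBump» §4)
  have hRK := RK_add_le_RK_raise_of_atQ 0 (D := D) (atQ3_of_atQ3VPx hAt)
  have hDk := D_le_k_of_atQ3VPx hAt
  have hnK := D_le_nKit_of_atQ3VPx hAt 0
  have hnL := D_le_nL_of_atQ3VPx hAt
    (KS.gT (KS.RK t O.merged 0 + D) (gxQ (KS.RK t O.merged 0 + D) (gxR0 (KS.RK t O.merged 0 + D)) (fxR (KS.RK t O.merged 0 + D))) κ Φ t p O.merged) (KS.fT (KS.RK t O.merged 0 + D) (fxQ (KS.RK t O.merged 0 + D) (fxR (KS.RK t O.merged 0 + D))) κ Φ t p O.merged)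
  have hnBF := D_le_nBF_of_atQ3VPx hAt (cF κ) (KS.RK t O.merged 0 + D)
  -- `hAt` and the goal at the seven U constructors of the raised index (§1)
  have hAtU := (atQ3V_tupleAllPx_iff (bv := BSlot.small3) D).1 (atQ3V_of_atQ3VPx hAt)
  rw [frmChoiceAllQ3VPx_eq, choiceAtQ3VPx_scheme_eq, choiceAtQ3VPx_FD_eq, scheme_tupleAllPx_eq D, FD_tupleAllPx_eq D]
  -- THE FIVE NODE ROWS: the U top's text («SkelFrmFrom1FaceHoldsQ3VNode») read at the raised index
  -- the tuple's facts at `(O, q)`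
  have hAt3 := atQ3_of_atQ3V hAtU
  have hAtT := atQ3T_of_atQ3 hAt3
  -- (`gOf/fOf` are unfolded by their equation lemmas — never by unification against the `KS.gT (KS.RK t O.merged 0 + D) (gxQ …)` towers)
  have hNL := eqNumL_of_atQT hAtT
  have hκ10 := (clauseL_of_atQT hAtT).2
  unfold gOf fOf at hNL hκ10
  have hKq : 13 ≤ Neg.Kq κ := PlanarSkeletonNeg.Neg.kq_ge_of_le κ (m := 12) (by omega)
  have hKq5 : 5 ≤ Neg.Kq κ := by omega
  -- the box row `4·K·(R′0+2) ≤ M_L` and the creep lemmas' floors on `g`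
  have hMR0 : 4 * Neg.K κ * (KS0.R'0 κ Φ t p O.merged (KS.RK t O.merged 0 + D) + 2) ≤ ML κ Φ t p O.merged (KS.gT (KS.RK t O.merged 0 + D) (gxQ (KS.RK t O.merged 0 + D) (gxR0 (KS.RK t O.merged 0 + D)) (fxR (KS.RK t O.merged 0 + D))) κ Φ t p O.merged) := by
    have h := (hR0F_of_ge (fun Dr => (le_gxQ (KS.RK t O.merged 0 + D) (gxR0 (KS.RK t O.merged 0 + D)) (fxR (KS.RK t O.merged 0 + D)) κ Φ t p Dr).2.1) O.merged).1
    have h4 : 4 * Neg.K κ ≤ 22000 * Neg.Kq κ := by rw [Neg.K_eq]; omega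
    exact (Nat.mul_le_mul_right (KS0.R'0 κ Φ t p O.merged (KS.RK t O.merged 0 + D) + 2) h4).trans h
  obtain ⟨hg, hg2⟩ := Hg_Q (κ := κ) (Φ := Φ) (t := t) (p := p) (KS.RK t O.merged 0 + D) (gxR0 (KS.RK t O.merged 0 + D)) (fxR (KS.RK t O.merged 0 + D)) O.merged
  -- the stride units vs the radii (`r_J = 40·Kq·u_J`, `6R′0 + 11 ≤ u_J`)
  have hU0 := uA_oth_factsR0 κ Φ t p O.merged (KS.fT (KS.RK t O.merged 0 + D) (fxQ (KS.RK t O.merged 0 + D) (fxR (KS.RK t O.merged 0 + D))) κ Φ t p O.merged) (KS.RK t O.merged 0 + D) (gxQ (KS.RK t O.merged 0 + D) (gxR0 (KS.RK t O.merged 0 + D)) (fxR (KS.RK t O.merged 0 + D))) hNL hκ10 hMR0 1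
  have hU1 := uA_oth_factsR0 κ Φ t p O.merged (KS.fT (KS.RK t O.merged 0 + D) (fxQ (KS.RK t O.merged 0 + D) (fxR (KS.RK t O.merged 0 + D))) κ Φ t p O.merged) (KS.RK t O.merged 0 + D) (gxQ (KS.RK t O.merged 0 + D) (gxR0 (KS.RK t O.merged 0 + D)) (fxR (KS.RK t O.merged 0 + D))) hNL hκ10 hMR0 0
  rw [show oth (1 : Fin 2) = 0 by decide, if_pos rfl] at hU0
  rw [show oth (0 : Fin 2) = 1 by decide, if_neg (by decide)] at hU1
  obtain ⟨hr0, hu0, -⟩ := hU0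
  obtain ⟨hr1, hu1, -⟩ := hU1
  have hKq' : (13 : ℤ) ≤ (Neg.Kq κ : ℤ) := by exact_mod_cast hKq
  have hR0 : (0 : ℤ) ≤ (KS0.R'0 κ Φ t p O.merged (KS.RK t O.merged 0 + D) : ℤ) := Nat.cast_nonneg _
  have hr0' : 480 * (KS.u₀A κ Φ t p O.merged (KS.gT (KS.RK t O.merged 0 + D) (gxQ (KS.RK t O.merged 0 + D) (gxR0 (KS.RK t O.merged 0 + D)) (fxR (KS.RK t O.merged 0 + D))) κ Φ t p O.merged) (KS.fT (KS.RK t O.merged 0 + D) (fxQ (KS.RK t O.merged 0 + D) (fxR (KS.RK t O.merged 0 + D))) κ Φ t p O.merged)) ≤ ((fcellsV κ Φ t p O.merged (KS.gT (KS.RK t O.merged 0 + D) (gxQ (KS.RK t O.merged 0 + D) (gxR0 (KS.RK t O.merged 0 + D)) (fxR (KS.RK t O.merged 0 + D))) κ Φ t p O.merged) (KS.fT (KS.RK t O.merged 0 + D) (fxQ (KS.RK t O.merged 0 + D) (fxR (KS.RK t O.merged 0 + D))) κ Φ t p O.merged) (cOf κ Φ t p O (KS.gT (KS.RK t O.merged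 0 + D) (gxQ (KS.RK t O.merged 0 + D) (gxR0 (KS.RK t O.merged 0 + D)) (fxR (KS.RK t O.merged 0 + D)))) (KS.fT (KS.RK t O.merged 0 + D) (fxQ (KS.RK t O.merged 0 + D) (fxR (KS.RK t O.merged 0 + D)))) (cR2W (KS.RK t O.merged 0 + D))) (hOf κ Φ t p O (KS.gT (KS.RK t O.merged 0 + D) (gxQ (KS.RK t O.merged 0 + D) (gxR0 (KS.RK t O.merged 0 + D)) (fxR (KS.RK t O.merged 0 + D)))) (KS.fT (KS.RK t O.merged 0 + D) (fxQ (KS.RK t O.merged 0 + D) (fxR (KS.RK t O.merged 0 + D)))) (hFR (KS.RK t O.merged 0 + D)))).r 0 : ℤ) := by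
    rw [fcellsV_r, hr0]; nlinarith
  have hr1' : 480 * (KS.u₁A κ Φ t p O.merged (KS.gT (KS.RK t O.merged 0 + D) (gxQ (KS.RK t O.merged 0 + D) (gxR0 (KS.RK t O.merged 0 + D)) (fxR (KS.RK t O.merged 0 + D))) κ Φ t p O.merged) (KS.fT (KS.RK t O.merged 0 + D) (fxQ (KS.RK t O.merged 0 + D) (fxR (KS.RK t O.merged 0 + D))) κ Φ t p O.merged)) ≤ ((fcellsV κ Φ t p O.merged (KS.gT (KS.RK t O.merged 0 + D) (gxQ (KS.RK t O.merged 0 + D) (gxR0 (KS.RK t O.merged 0 + D)) (fxR (KS.RK t O.merged 0 + D))) κ Φ t p O.merged) (KS.fT (KS.RK t O.merged 0 + D) (fxQ (KS.RK t O.merged 0 + D) (fxR (KS.RK t O.merged 0 + D))) κ Φ t p O.merged) (cOf κ Φ t p O (KS.gT (KS.RK t O.merged 0 + D) (gxQ (KS.RK t O.merged 0 + D) (gxR0 (KS.RK t O.merged 0 + D)) (fxR (KS.RK t O.merged 0 + D)))) (KS.fT (KS.RK t O.merged 0 + D) (fxQ (KS.RK t O.merged 0 + D) (fxR (KS.RK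 t O.merged 0 + D)))) (cR2W (KS.RK t O.merged 0 + D))) (hOf κ Φ t p O (KS.gT (KS.RK t O.merged 0 + D) (gxQ (KS.RK t O.merged 0 + D) (gxR0 (KS.RK t O.merged 0 + D)) (fxR (KS.RK t O.merged 0 + D)))) (KS.fT (KS.RK t O.merged 0 + D) (fxQ (KS.RK t O.merged 0 + D) (fxR (KS.RK t O.merged 0 + D)))) (hFR (KS.RK t O.merged 0 + D)))).r 1 : ℤ) := by
    rw [fcellsV_r, hr1]; nlinarith
  -- the creep and the forward room of the cells (truncations are identities / upper bounds)
  have ecv : cOf κ Φ t p O (KS.gT (KS.RK t O.merged 0 + D) (gxQ (KS.RK t O.merged 0 + D) (gxR0 (KS.RK t O.merged 0 + D)) (fxR (KS.RK t O.merged 0 + D)))) (KS.fT (KS.RK t O.merged 0 + D) (fxQ (KS.RK t O.merged 0 + D) (fxR (KS.RK t O.merged 0 + D)))) (cR2W (KS.RK t O.merged 0 + D)) = (cR2vW κ Φ t p O.merged (KS.gT (KS.RK t O.merged 0 + D) (gxQ (KS.RK t O.merged 0 + D) (gxR0 (KS.RK t O.merged 0 + D)) (fxR (KS.RK t O.merged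 0 + D))) κ Φ t p O.merged) (KS.fT (KS.RK t O.merged 0 + D) (fxQ (KS.RK t O.merged 0 + D) (fxR (KS.RK t O.merged 0 + D))) κ Φ t p O.merged) (KS.RK t O.merged 0 + D)) := by
    simp only [cOf, gOf, fOf, cR2W]
  have ehv : hOf κ Φ t p O (KS.gT (KS.RK t O.merged 0 + D) (gxQ (KS.RK t O.merged 0 + D) (gxR0 (KS.RK t O.merged 0 + D)) (fxR (KS.RK t O.merged 0 + D)))) (KS.fT (KS.RK t O.merged 0 + D) (fxQ (KS.RK t O.merged 0 + D) (fxR (KS.RK t O.merged 0 + D)))) (hFR (KS.RK t O.merged 0 + D)) = (hFRv κ Φ t p O.merged (KS.gT (KS.RK t O.merged 0 + D) (gxQ (KS.RK t O.merged 0 + D) (gxR0 (KS.RK t O.merged 0 + D)) (fxR (KS.RK t O.merged 0 + D))) κ Φ t p O.merged) (KS.fT (KS.RK t O.merged 0 + D) (fxQ (KS.RK t O.merged 0 + D) (fxR (KS.RK t O.merged 0 + D))) κ Φ t p O.merged) (KS.RK t O.merged 0 + D)) := by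
    simp only [hOf, gOf, fOf, hFR]
  have hcle := cR2vW_le_r_oth κ Φ t p O.merged (KS.gT (KS.RK t O.merged 0 + D) (gxQ (KS.RK t O.merged 0 + D) (gxR0 (KS.RK t O.merged 0 + D)) (fxR (KS.RK t O.merged 0 + D))) κ Φ t p O.merged) (KS.fT (KS.RK t O.merged 0 + D) (fxQ (KS.RK t O.merged 0 + D) (fxR (KS.RK t O.merged 0 + D))) κ Φ t p O.merged) (KS.RK t O.merged 0 + D) hKq5 hNL hg hg2
  have hc0 : ((fcellsV κ Φ t p O.merged (KS.gT (KS.RK t O.merged 0 + D) (gxQ (KS.RK t O.merged 0 + D) (gxR0 (KS.RK t O.merged 0 + D)) (fxR (KS.RK t O.merged 0 + D))) κ Φ t p O.merged) (KS.fT (KS.RK t O.merged 0 + D) (fxQ (KS.RK t O.merged 0 + D) (fxR (KS.RK t O.merged 0 + D))) κ Φ t p O.merged) (cOf κ Φ t p O (KS.gT (KS.RK t O.merged 0 + D) (gxQ (KS.RK t O.merged 0 + D) (gxR0 (KS.RK t O.merged 0 + D)) (fxR (KS.RK t O.merged 0 + D)))) (KS.fT (KS.RK t O.merged 0 + D) (fxQ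 (KS.RK t O.merged 0 + D) (fxR (KS.RK t O.merged 0 + D)))) (cR2W (KS.RK t O.merged 0 + D))) (hOf κ Φ t p O (KS.gT (KS.RK t O.merged 0 + D) (gxQ (KS.RK t O.merged 0 + D) (gxR0 (KS.RK t O.merged 0 + D)) (fxR (KS.RK t O.merged 0 + D)))) (KS.fT (KS.RK t O.merged 0 + D) (fxQ (KS.RK t O.merged 0 + D) (fxR (KS.RK t O.merged 0 + D)))) (hFR (KS.RK t O.merged 0 + D)))).c 0 : ℤ) = (((cR2vW κ Φ t p O.merged (KS.gT (KS.RK t O.merged 0 + D) (gxQ (KS.RK t O.merged 0 + D) (gxR0 (KS.RK t O.merged 0 + D)) (fxR (KS.RK t O.merged 0 + D))) κ Φ t p O.merged) (KS.fT (KS.RK t O.merged 0 + D) (fxQ (KS.RK t O.merged 0 + D) (fxR (KS.RK t O.merged 0 + D))) κ Φ t p O.merged) (KS.RK t O.merged 0 + D)) 0 : ℕ) : ℤ) := by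
    rw [fcellsV_c, ecv, cT_eq κ Φ t p O.merged (KS.gT (KS.RK t O.merged 0 + D) (gxQ (KS.RK t O.merged 0 + D) (gxR0 (KS.RK t O.merged 0 + D)) (fxR (KS.RK t O.merged 0 + D))) κ Φ t p O.merged) (KS.fT (KS.RK t O.merged 0 + D) (fxQ (KS.RK t O.merged 0 + D) (fxR (KS.RK t O.merged 0 + D))) κ Φ t p O.merged) _ hcle]
  have hc1 : ((fcellsV κ Φ t p O.merged (KS.gT (KS.RK t O.merged 0 + D) (gxQ (KS.RK t O.merged 0 + D) (gxR0 (KS.RK t O.merged 0 + D)) (fxR (KS.RK t O.merged 0 + D))) κ Φ t p O.merged) (KS.fT (KS.RK t O.merged 0 + D) (fxQ (KS.RK t O.merged 0 + D) (fxR (KS.RK t O.merged 0 + D))) κ Φ t p O.merged) (cOf κ Φ t p O (KS.gT (KS.RK t O.merged 0 + D) (gxQ (KS.RK t O.merged 0 + D) (gxR0 (KS.RK t O.merged 0 + D)) (fxR (KS.RK t O.merged 0 + D)))) (KS.fT (KS.RK t O.merged 0 + D) (fxQ (KS.RK t O.merged 0 + D) (fxR (KS.RK t O.merged 0 + D))))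 (cR2W (KS.RK t O.merged 0 + D))) (hOf κ Φ t p O (KS.gT (KS.RK t O.merged 0 + D) (gxQ (KS.RK t O.merged 0 + D) (gxR0 (KS.RK t O.merged 0 + D)) (fxR (KS.RK t O.merged 0 + D)))) (KS.fT (KS.RK t O.merged 0 + D) (fxQ (KS.RK t O.merged 0 + D) (fxR (KS.RK t O.merged 0 + D)))) (hFR (KS.RK t O.merged 0 + D)))).c 1 : ℤ) = (((cR2vW κ Φ t p O.merged (KS.gT (KS.RK t O.merged 0 + D) (gxQ (KS.RK t O.merged 0 + D) (gxR0 (KS.RK t O.merged 0 + D)) (fxR (KS.RK t O.merged 0 + D))) κ Φ t p O.merged) (KS.fT (KS.RK t O.merged 0 + D) (fxQ (KS.RK t O.merged 0 + D) (fxR (KS.RK t O.merged 0 + D))) κ Φ t p O.merged) (KS.RK t O.merged 0 + D)) 1 : ℕ) : ℤ) := by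
    rw [fcellsV_c, ecv, cT_eq κ Φ t p O.merged (KS.gT (KS.RK t O.merged 0 + D) (gxQ (KS.RK t O.merged 0 + D) (gxR0 (KS.RK t O.merged 0 + D)) (fxR (KS.RK t O.merged 0 + D))) κ Φ t p O.merged) (KS.fT (KS.RK t O.merged 0 + D) (fxQ (KS.RK t O.merged 0 + D) (fxR (KS.RK t O.merged 0 + D))) κ Φ t p O.merged) _ hcle]
  have hF0 : ((fcellsV κ Φ t p O.merged (KS.gT (KS.RK t O.merged 0 + D) (gxQ (KS.RK t O.merged 0 + D) (gxR0 (KS.RK t O.merged 0 + D)) (fxR (KS.RK t O.merged 0 + D))) κ Φ t p O.merged) (KS.fT (KS.RK t O.merged 0 + D) (fxQ (KS.RK t O.merged 0 + D) (fxR (KS.RK t O.merged 0 + D))) κ Φ t p O.merged) (cOf κ Φ t p O (KS.gT (KS.RK t O.merged 0 + D) (gxQ (KS.RK t O.merged 0 + D) (gxR0 (KS.RK t O.merged 0 + D)) (fxR (KS.RK t O.merged 0 + D)))) (KS.fT (KS.RK t O.merged 0 + D) (fxQ (KS.RK t O.merged 0 + D) (fxR (KS.RK t O.merged 0 + D))))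 (cR2W (KS.RK t O.merged 0 + D))) (hOf κ Φ t p O (KS.gT (KS.RK t O.merged 0 + D) (gxQ (KS.RK t O.merged 0 + D) (gxR0 (KS.RK t O.merged 0 + D)) (fxR (KS.RK t O.merged 0 + D)))) (KS.fT (KS.RK t O.merged 0 + D) (fxQ (KS.RK t O.merged 0 + D) (fxR (KS.RK t O.merged 0 + D)))) (hFR (KS.RK t O.merged 0 + D)))).hF 0 : ℤ) ≤ (((hFRv κ Φ t p O.merged (KS.gT (KS.RK t O.merged 0 + D) (gxQ (KS.RK t O.merged 0 + D) (gxR0 (KS.RK t O.merged 0 + D)) (fxR (KS.RK t O.merged 0 + D))) κ Φ t p O.merged) (KS.fT (KS.RK t O.merged 0 + D) (fxQ (KS.RK t O.merged 0 + D) (fxR (KS.RK t O.merged 0 + D))) κ Φ t p O.merged) (KS.RK t O.merged 0 + D)) 0 : ℕ) : ℤ) := by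
    rw [fcellsV_hF, ehv]; exact_mod_cast (hFV_le κ Φ t p O.merged (KS.gT (KS.RK t O.merged 0 + D) (gxQ (KS.RK t O.merged 0 + D) (gxR0 (KS.RK t O.merged 0 + D)) (fxR (KS.RK t O.merged 0 + D))) κ Φ t p O.merged) (KS.fT (KS.RK t O.merged 0 + D) (fxQ (KS.RK t O.merged 0 + D) (fxR (KS.RK t O.merged 0 + D))) κ Φ t p O.merged) _ 0).2
  have hF1 : ((fcellsV κ Φ t p O.merged (KS.gT (KS.RK t O.merged 0 + D) (gxQ (KS.RK t O.merged 0 + D) (gxR0 (KS.RK t O.merged 0 + D)) (fxR (KS.RK t O.merged 0 + D))) κ Φ t p O.merged) (KS.fT (KS.RK t O.merged 0 + D) (fxQ (KS.RK t O.merged 0 + D) (fxR (KS.RK t O.merged 0 + D))) κ Φ t p O.merged) (cOf κ Φ t p O (KS.gT (KS.RK t O.merged 0 + D) (gxQ (KS.RK t O.merged 0 + D) (gxR0 (KS.RK t O.merged 0 + D)) (fxR (KS.RK t O.merged 0 + D)))) (KS.fT (KS.RK t O.merged 0 + D) (fxQ (KS.RK t O.merged 0 + D) (fxR (KS.RK t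 O.merged 0 + D)))) (cR2W (KS.RK t O.merged 0 + D))) (hOf κ Φ t p O (KS.gT (KS.RK t O.merged 0 + D) (gxQ (KS.RK t O.merged 0 + D) (gxR0 (KS.RK t O.merged 0 + D)) (fxR (KS.RK t O.merged 0 + D)))) (KS.fT (KS.RK t O.merged 0 + D) (fxQ (KS.RK t O.merged 0 + D) (fxR (KS.RK t O.merged 0 + D)))) (hFR (KS.RK t O.merged 0 + D)))).hF 1 : ℤ) ≤ (((hFRv κ Φ t p O.merged (KS.gT (KS.RK t O.merged 0 + D) (gxQ (KS.RK t O.merged 0 + D) (gxR0 (KS.RK t O.merged 0 + D)) (fxR (KS.RK t O.merged 0 + D))) κ Φ t p O.merged) (KS.fT (KS.RK t O.merged 0 + D) (fxQ (KS.RK t O.merged 0 + D) (fxR (KS.RK t O.merged 0 + D))) κ Φ t p O.merged) (KS.RK t O.merged 0 + D)) 1 : ℕ) : ℤ) := by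
    rw [fcellsV_hF, ehv]; exact_mod_cast (hFV_le κ Φ t p O.merged (KS.gT (KS.RK t O.merged 0 + D) (gxQ (KS.RK t O.merged 0 + D) (gxR0 (KS.RK t O.merged 0 + D)) (fxR (KS.RK t O.merged 0 + D))) κ Φ t p O.merged) (KS.fT (KS.RK t O.merged 0 + D) (fxQ (KS.RK t O.merged 0 + D) (fxR (KS.RK t O.merged 0 + D))) κ Φ t p O.merged) _ 1).2
  obtain ⟨eH0, eH1⟩ := hFRv_apply κ Φ t p O.merged (KS.gT (KS.RK t O.merged 0 + D) (gxQ (KS.RK t O.merged 0 + D) (gxR0 (KS.RK t O.merged 0 + D)) (fxR (KS.RK t O.merged 0 + D))) κ Φ t p O.merged) (KS.fT (KS.RK t O.merged 0 + D) (fxQ (KS.RK t O.merged 0 + D) (fxR (KS.RK t O.merged 0 + D))) κ Φ t p O.merged) (KS.RK t O.merged 0 + D)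
  obtain ⟨eC0, eC1⟩ := cR2vW_apply κ Φ t p O.merged (KS.gT (KS.RK t O.merged 0 + D) (gxQ (KS.RK t O.merged 0 + D) (gxR0 (KS.RK t O.merged 0 + D)) (fxR (KS.RK t O.merged 0 + D))) κ Φ t p O.merged) (KS.fT (KS.RK t O.merged 0 + D) (fxQ (KS.RK t O.merged 0 + D) (fxR (KS.RK t O.merged 0 + D))) κ Φ t p O.merged) (KS.RK t O.merged 0 + D)
  obtain ⟨hcap0, hcap1⟩ := cR2vW_caps κ Φ t p O.merged (KS.gT (KS.RK t O.merged 0 + D) (gxQ (KS.RK t O.merged 0 + D) (gxR0 (KS.RK t O.merged 0 + D)) (fxR (KS.RK t O.merged 0 + D))) κ Φ t p O.merged) (KS.fT (KS.RK t O.merged 0 + D) (fxQ (KS.RK t O.merged 0 + D) (fxR (KS.RK t O.merged 0 + D))) κ Φ t p O.merged) (KS.RK t O.merged 0 + D) hKq5 hNL hg hg2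
  have hhF0 : ((fcellsV κ Φ t p O.merged (KS.gT (KS.RK t O.merged 0 + D) (gxQ (KS.RK t O.merged 0 + D) (gxR0 (KS.RK t O.merged 0 + D)) (fxR (KS.RK t O.merged 0 + D))) κ Φ t p O.merged) (KS.fT (KS.RK t O.merged 0 + D) (fxQ (KS.RK t O.merged 0 + D) (fxR (KS.RK t O.merged 0 + D))) κ Φ t p O.merged) (cOf κ Φ t p O (KS.gT (KS.RK t O.merged 0 + D) (gxQ (KS.RK t O.merged 0 + D) (gxR0 (KS.RK t O.merged 0 + D)) (fxR (KS.RK t O.merged 0 + D)))) (KS.fT (KS.RK t O.merged 0 + D) (fxQ (KS.RK t O.merged 0 + D) (fxR (KS.RK t O.merged 0 + D)))) (cR2W (KS.RK t O.merged 0 + D))) (hOf κ Φ t p O (KS.gT (KS.RK t O.merged 0 + D) (gxQ (KS.RK t O.merged 0 + D) (gxR0 (KS.RK t O.merged 0 + D)) (fxR (KS.RK t O.merged 0 + D)))) (KS.fT (KS.RK t O.merged 0 + D) (fxQ (KS.RK t O.merged 0 + D) (fxR (KS.RK t O.merged 0 + D)))) (hFR (KS.RK t O.merged 0 + D)))).hF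 0 : ℤ) ≤ (((cR2vW κ Φ t p O.merged (KS.gT (KS.RK t O.merged 0 + D) (gxQ (KS.RK t O.merged 0 + D) (gxR0 (KS.RK t O.merged 0 + D)) (fxR (KS.RK t O.merged 0 + D))) κ Φ t p O.merged) (KS.fT (KS.RK t O.merged 0 + D) (fxQ (KS.RK t O.merged 0 + D) (fxR (KS.RK t O.merged 0 + D))) κ Φ t p O.merged) (KS.RK t O.merged 0 + D)) 0 : ℕ) : ℤ) + 5 * (KS.u₁A κ Φ t p O.merged (KS.gT (KS.RK t O.merged 0 + D) (gxQ (KS.RK t O.merged 0 + D) (gxR0 (KS.RK t O.merged 0 + D)) (fxR (KS.RK t O.merged 0 + D))) κ Φ t p O.merged) (KS.fT (KS.RK t O.merged 0 + D) (fxQ (KS.RK t O.merged 0 + D) (fxR (KS.RK t O.merged 0 + D))) κ Φ t p O.merged)) + 2 := by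
    rw [eC0]; rw [eH0] at hF0; unfold KS.u₁A; push_cast at hF0 ⊢; linarith
  have hhF1 : ((fcellsV κ Φ t p O.merged (KS.gT (KS.RK t O.merged 0 + D) (gxQ (KS.RK t O.merged 0 + D) (gxR0 (KS.RK t O.merged 0 + D)) (fxR (KS.RK t O.merged 0 + D))) κ Φ t p O.merged) (KS.fT (KS.RK t O.merged 0 + D) (fxQ (KS.RK t O.merged 0 + D) (fxR (KS.RK t O.merged 0 + D))) κ Φ t p O.merged) (cOf κ Φ t p O (KS.gT (KS.RK t O.merged 0 + D) (gxQ (KS.RK t O.merged 0 + D) (gxR0 (KS.RK t O.merged 0 + D)) (fxR (KS.RK t O.merged 0 + D)))) (KS.fT (KS.RK t O.merged 0 + D) (fxQ (KS.RK t O.merged 0 + D) (fxR (KS.RK t O.merged 0 + D)))) (cR2W (KS.RK t O.merged 0 + D))) (hOf κ Φ t p O (KS.gT (KS.RK t O.merged 0 + D) (gxQ (KS.RK t O.merged 0 + D) (gxR0 (KS.RK t O.merged 0 + D)) (fxR (KS.RK t O.merged 0 + D)))) (KS.fT (KS.RK t O.merged 0 + D) (fxQ (KS.RK t O.merged 0 +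 D) (fxR (KS.RK t O.merged 0 + D)))) (hFR (KS.RK t O.merged 0 + D)))).hF 1 : ℤ) ≤ (((cR2vW κ Φ t p O.merged (KS.gT (KS.RK t O.merged 0 + D) (gxQ (KS.RK t O.merged 0 + D) (gxR0 (KS.RK t O.merged 0 + D)) (fxR (KS.RK t O.merged 0 + D))) κ Φ t p O.merged) (KS.fT (KS.RK t O.merged 0 + D) (fxQ (KS.RK t O.merged 0 + D) (fxR (KS.RK t O.merged 0 + D))) κ Φ t p O.merged) (KS.RK t O.merged 0 + D)) 1 : ℕ) : ℤ) + 54 * (KS.u₀A κ Φ t p O.merged (KS.gT (KS.RK t O.merged 0 + D) (gxQ (KS.RK t O.merged 0 + D) (gxR0 (KS.RK t O.merged 0 + D)) (fxR (KS.RK t O.merged 0 + D))) κ Φ t p O.merged) (KS.fT (KS.RK t O.merged 0 + D) (fxQ (KS.RK t O.merged 0 + D) (fxR (KS.RK t O.merged 0 + D))) κ Φ t p O.merged)) + 2 := by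
    rw [eC1]; rw [eH1] at hF1; unfold KS.u₀A; push_cast at hF1 ⊢; linarith
  have hcap0' : (((cR2vW κ Φ t p O.merged (KS.gT (KS.RK t O.merged 0 + D) (gxQ (KS.RK t O.merged 0 + D) (gxR0 (KS.RK t O.merged 0 + D)) (fxR (KS.RK t O.merged 0 + D))) κ Φ t p O.merged) (KS.fT (KS.RK t O.merged 0 + D) (fxQ (KS.RK t O.merged 0 + D) (fxR (KS.RK t O.merged 0 + D))) κ Φ t p O.merged) (KS.RK t O.merged 0 + D)) 0 : ℕ) : ℤ) ≤ 30 * (KS.u₁A κ Φ t p O.merged (KS.gT (KS.RK t O.merged 0 + D) (gxQ (KS.RK t O.merged 0 + D) (gxR0 (KS.RK t O.merged 0 + D)) (fxR (KS.RK t O.merged 0 + D))) κ Φ t p O.merged) (KS.fT (KS.RK t O.merged 0 + D) (fxQ (KS.RK t O.merged 0 + D) (fxR (KS.RK t O.merged 0 + D))) κ Φ t p O.merged)) + 1 := by unfold KS.u₁A; exact hcap0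
  have hcap1' : (((cR2vW κ Φ t p O.merged (KS.gT (KS.RK t O.merged 0 + D) (gxQ (KS.RK t O.merged 0 + D) (gxR0 (KS.RK t O.merged 0 + D)) (fxR (KS.RK t O.merged 0 + D))) κ Φ t p O.merged) (KS.fT (KS.RK t O.merged 0 + D) (fxQ (KS.RK t O.merged 0 + D) (fxR (KS.RK t O.merged 0 + D))) κ Φ t p O.merged) (KS.RK t O.merged 0 + D)) 1 : ℕ) : ℤ) ≤ 126 * (KS.u₀A κ Φ t p O.merged (KS.gT (KS.RK t O.merged 0 + D) (gxQ (KS.RK t O.merged 0 + D) (gxR0 (KS.RK t O.merged 0 + D)) (fxR (KS.RK t O.merged 0 + D))) κ Φ t p O.merged) (KS.fT (KS.RK t O.merged 0 + D) (fxQ (KS.RK t O.merged 0 + D) (fxR (KS.RK t O.merged 0 + D))) κ Φ t p O.merged)) := by unfold KS.u₀A; exact hcap1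
  -- the windows
  obtain ⟨es0, es1⟩ := small3_eq κ Φ t p O.merged (KS.gT (KS.RK t O.merged 0 + D) (gxQ (KS.RK t O.merged 0 + D) (gxR0 (KS.RK t O.merged 0 + D)) (fxR (KS.RK t O.merged 0 + D))) κ Φ t p O.merged) (KS.fT (KS.RK t O.merged 0 + D) (fxQ (KS.RK t O.merged 0 + D) (fxR (KS.RK t O.merged 0 + D))) κ Φ t p O.merged)
  have hbX : 13 * (KS.u₁A κ Φ t p O.merged (KS.gT (KS.RK t O.merged 0 + D) (gxQ (KS.RK t O.merged 0 + D) (gxR0 (KS.RK t O.merged 0 + D)) (fxR (KS.RK t O.merged 0 + D))) κ Φ t p O.merged) (KS.fT (KS.RK t O.merged 0 + D) (fxQ (KS.RK t O.merged 0 + D) (fxR (KS.RK t O.merged 0 + D))) κ Φ t p O.merged)) ≤ ((KS.bwX κ Φ t p O.merged (KS.gT (KS.RK t O.merged 0 + D) (gxQ (KS.RK t O.merged 0 + D) (gxR0 (KS.RK t O.merged 0 + D)) (fxR (KS.RK t O.merged 0 + D))) κ Φ t p O.merged) (KS.fT (KS.RK t O.merged 0 + D) (fxQ (KS.RK t O.merged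 0 + D) (fxR (KS.RK t O.merged 0 + D))) κ Φ t p O.merged)) : ℤ) := by
    have h := (KS.bwX_eq κ Φ t p O.merged (KS.gT (KS.RK t O.merged 0 + D) (gxQ (KS.RK t O.merged 0 + D) (gxR0 (KS.RK t O.merged 0 + D)) (fxR (KS.RK t O.merged 0 + D))) κ Φ t p O.merged) (KS.fT (KS.RK t O.merged 0 + D) (fxQ (KS.RK t O.merged 0 + D) (fxR (KS.RK t O.merged 0 + D))) κ Φ t p O.merged)).1; rw [es1] at h; unfold KS.u₁A at h ⊢; push_cast at h; linarith
  have hbY : 69 * (KS.u₀A κ Φ t p O.merged (KS.gT (KS.RK t O.merged 0 + D) (gxQ (KS.RK t O.merged 0 + D) (gxR0 (KS.RK t O.merged 0 + D)) (fxR (KS.RK t O.merged 0 + D))) κ Φ t p O.merged) (KS.fT (KS.RK t O.merged 0 + D) (fxQ (KS.RK t O.merged 0 + D) (fxR (KS.RK t O.merged 0 + D))) κ Φ t p O.merged)) ≤ ((KS.bwY κ Φ t p O.merged (KS.gT (KS.RK t O.merged 0 + D) (gxQ (KS.RK t O.merged 0 + D) (gxR0 (KS.RK t O.merged 0 + D))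 (fxR (KS.RK t O.merged 0 + D))) κ Φ t p O.merged) (KS.fT (KS.RK t O.merged 0 + D) (fxQ (KS.RK t O.merged 0 + D) (fxR (KS.RK t O.merged 0 + D))) κ Φ t p O.merged)) : ℤ) := by
    have h := (KS.bwY_eq κ Φ t p O.merged (KS.gT (KS.RK t O.merged 0 + D) (gxQ (KS.RK t O.merged 0 + D) (gxR0 (KS.RK t O.merged 0 + D)) (fxR (KS.RK t O.merged 0 + D))) κ Φ t p O.merged) (KS.fT (KS.RK t O.merged 0 + D) (fxQ (KS.RK t O.merged 0 + D) (fxR (KS.RK t O.merged 0 + D))) κ Φ t p O.merged)).1; rw [es0] at h; unfold KS.u₀A at h ⊢; push_cast at h; linarith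
  -- the band `E − 1 ≤ 2R′0 − 3`
  have hE1 : 1 ≤ (KS0.Rlev0 κ Φ t p O.merged (KS.RK t O.merged 0 + D) + KS0.reach0 t O.merged (KS.RK t O.merged 0 + D)) := by unfold KS0.reach0; omega
  have hEc : ((((KS0.Rlev0 κ Φ t p O.merged (KS.RK t O.merged 0 + D) + KS0.reach0 t O.merged (KS.RK t O.merged 0 + D)) - 1 : ℕ)) : ℤ) = ((KS0.Rlev0 κ Φ t p O.merged (KS.RK t O.merged 0 + D) + KS0.reach0 t O.merged (KS.RK t O.merged 0 + D)) : ℤ) - 1 := by omega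
  have hReach : KS0.reach0 t O.merged (KS.RK t O.merged 0 + D) < KS0.R'0 κ Φ t p O.merged (KS.RK t O.merged 0 + D) := (KS0.T0_lt_R'0 κ Φ t p O.merged (KS.RK t O.merged 0 + D)).2.2.1
  have hR' : KS0.R'0 κ Φ t p O.merged (KS.RK t O.merged 0 + D) = KS0.Rlev0 κ Φ t p O.merged (KS.RK t O.merged 0 + D) + 1 := rfl
  have he : ((((KS0.Rlev0 κ Φ t p O.merged (KS.RK t O.merged 0 + D) + KS0.reach0 t O.merged (KS.RK t O.merged 0 + D)) - 1 : ℕ)) : ℤ) + 3 ≤ 2 * (KS0.R'0 κ Φ t p O.merged (KS.RK t O.merged 0 + D) : ℤ) := by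
    rw [hEc]; omega
  -- the arithmetic
  have H := faceNodeRows_arith_le ((fcellsV κ Φ t p O.merged (KS.gT (KS.RK t O.merged 0 + D) (gxQ (KS.RK t O.merged 0 + D) (gxR0 (KS.RK t O.merged 0 + D)) (fxR (KS.RK t O.merged 0 + D))) κ Φ t p O.merged) (KS.fT (KS.RK t O.merged 0 + D) (fxQ (KS.RK t O.merged 0 + D) (fxR (KS.RK t O.merged 0 + D))) κ Φ t p O.merged) (cOf κ Φ t p O (KS.gT (KS.RK t O.merged 0 + D) (gxQ (KS.RK t O.merged 0 + D) (gxR0 (KS.RK t O.merged 0 + D)) (fxR (KS.RK t O.merged 0 + D)))) (KS.fT (KS.RK t O.merged 0 + D) (fxQ (KS.RK t O.merged 0 + D) (fxR (KS.RK t O.merged 0 + D)))) (cR2W (KS.RK t O.merged 0 + D))) (hOf κ Φ t p O (KS.gT (KS.RK t O.merged 0 + D) (gxQ (KS.RK t O.merged 0 + D) (gxR0 (KS.RK t O.merged 0 + D)) (fxR (KS.RK t O.merged 0 + D)))) (KS.fT (KS.RK t O.merged 0 + D) (fxQ (KS.RK t O.merged 0 + D) (fxR (KS.RK t O.merged 0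 + D)))) (hFR (KS.RK t O.merged 0 + D)))).c 0) ((fcellsV κ Φ t p O.merged (KS.gT (KS.RK t O.merged 0 + D) (gxQ (KS.RK t O.merged 0 + D) (gxR0 (KS.RK t O.merged 0 + D)) (fxR (KS.RK t O.merged 0 + D))) κ Φ t p O.merged) (KS.fT (KS.RK t O.merged 0 + D) (fxQ (KS.RK t O.merged 0 + D) (fxR (KS.RK t O.merged 0 + D))) κ Φ t p O.merged) (cOf κ Φ t p O (KS.gT (KS.RK t O.merged 0 + D) (gxQ (KS.RK t O.merged 0 + D) (gxR0 (KS.RK t O.merged 0 + D)) (fxR (KS.RK t O.merged 0 + D)))) (KS.fT (KS.RK t O.merged 0 + D) (fxQ (KS.RK t O.merged 0 + D) (fxR (KS.RK t O.merged 0 + D)))) (cR2W (KS.RK t O.merged 0 + D))) (hOf κ Φ t p O (KS.gT (KS.RK t O.merged 0 + D) (gxQ (KS.RK t O.merged 0 + D) (gxR0 (KS.RK t O.merged 0 + D)) (fxR (KS.RK t O.merged 0 + D)))) (KS.fT (KS.RK t O.merged 0 + D) (fxQ (KS.RK t O.merged 0 + D) (fxR (KS.RK t O.merged 0 + D)))) (hFR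 (KS.RK t O.merged 0 + D)))).c 1) ((fcellsV κ Φ t p O.merged (KS.gT (KS.RK t O.merged 0 + D) (gxQ (KS.RK t O.merged 0 + D) (gxR0 (KS.RK t O.merged 0 + D)) (fxR (KS.RK t O.merged 0 + D))) κ Φ t p O.merged) (KS.fT (KS.RK t O.merged 0 + D) (fxQ (KS.RK t O.merged 0 + D) (fxR (KS.RK t O.merged 0 + D))) κ Φ t p O.merged) (cOf κ Φ t p O (KS.gT (KS.RK t O.merged 0 + D) (gxQ (KS.RK t O.merged 0 + D) (gxR0 (KS.RK t O.merged 0 + D)) (fxR (KS.RK t O.merged 0 + D)))) (KS.fT (KS.RK t O.merged 0 + D) (fxQ (KS.RK t O.merged 0 + D) (fxR (KS.RK t O.merged 0 + D)))) (cR2W (KS.RK t O.merged 0 + D))) (hOf κ Φ t p O (KS.gT (KS.RK t O.merged 0 + D) (gxQ (KS.RK t O.merged 0 + D) (gxR0 (KS.RK t O.merged 0 + D)) (fxR (KS.RK t O.merged 0 + D)))) (KS.fT (KS.RK t O.merged 0 + D) (fxQ (KS.RK t O.merged 0 + D) (fxR (KS.RK t O.merged 0 + D)))) (hFR (KS.RK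 t O.merged 0 + D)))).hF 0) ((fcellsV κ Φ t p O.merged (KS.gT (KS.RK t O.merged 0 + D) (gxQ (KS.RK t O.merged 0 + D) (gxR0 (KS.RK t O.merged 0 + D)) (fxR (KS.RK t O.merged 0 + D))) κ Φ t p O.merged) (KS.fT (KS.RK t O.merged 0 + D) (fxQ (KS.RK t O.merged 0 + D) (fxR (KS.RK t O.merged 0 + D))) κ Φ t p O.merged) (cOf κ Φ t p O (KS.gT (KS.RK t O.merged 0 + D) (gxQ (KS.RK t O.merged 0 + D) (gxR0 (KS.RK t O.merged 0 + D)) (fxR (KS.RK t O.merged 0 + D)))) (KS.fT (KS.RK t O.merged 0 + D) (fxQ (KS.RK t O.merged 0 + D) (fxR (KS.RK t O.merged 0 + D)))) (cR2W (KS.RK t O.merged 0 + D))) (hOf κ Φ t p O (KS.gT (KS.RK t O.merged 0 + D) (gxQ (KS.RK t O.merged 0 + D) (gxR0 (KS.RK t O.merged 0 + D)) (fxR (KS.RK t O.merged 0 + D)))) (KS.fT (KS.RK t O.merged 0 + D) (fxQ (KS.RK t O.merged 0 + D) (fxR (KS.RK t O.merged 0 + D)))) (hFR (KS.RK t O.merged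 0 + D)))).hF 1) ((fcellsV κ Φ t p O.merged (KS.gT (KS.RK t O.merged 0 + D) (gxQ (KS.RK t O.merged 0 + D) (gxR0 (KS.RK t O.merged 0 + D)) (fxR (KS.RK t O.merged 0 + D))) κ Φ t p O.merged) (KS.fT (KS.RK t O.merged 0 + D) (fxQ (KS.RK t O.merged 0 + D) (fxR (KS.RK t O.merged 0 + D))) κ Φ t p O.merged) (cOf κ Φ t p O (KS.gT (KS.RK t O.merged 0 + D) (gxQ (KS.RK t O.merged 0 + D) (gxR0 (KS.RK t O.merged 0 + D)) (fxR (KS.RK t O.merged 0 + D)))) (KS.fT (KS.RK t O.merged 0 + D) (fxQ (KS.RK t O.merged 0 + D) (fxR (KS.RK t O.merged 0 + D)))) (cR2W (KS.RK t O.merged 0 + D))) (hOf κ Φ t p O (KS.gT (KS.RK t O.merged 0 + D) (gxQ (KS.RK t O.merged 0 + D) (gxR0 (KS.RK t O.merged 0 + D)) (fxR (KS.RK t O.merged 0 + D)))) (KS.fT (KS.RK t O.merged 0 + D) (fxQ (KS.RK t O.merged 0 + D) (fxR (KS.RK t O.merged 0 + D)))) (hFR (KS.RK t O.merged 0 + D)))).r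 0) ((fcellsV κ Φ t p O.merged (KS.gT (KS.RK t O.merged 0 + D) (gxQ (KS.RK t O.merged 0 + D) (gxR0 (KS.RK t O.merged 0 + D)) (fxR (KS.RK t O.merged 0 + D))) κ Φ t p O.merged) (KS.fT (KS.RK t O.merged 0 + D) (fxQ (KS.RK t O.merged 0 + D) (fxR (KS.RK t O.merged 0 + D))) κ Φ t p O.merged) (cOf κ Φ t p O (KS.gT (KS.RK t O.merged 0 + D) (gxQ (KS.RK t O.merged 0 + D) (gxR0 (KS.RK t O.merged 0 + D)) (fxR (KS.RK t O.merged 0 + D)))) (KS.fT (KS.RK t O.merged 0 + D) (fxQ (KS.RK t O.merged 0 + D) (fxR (KS.RK t O.merged 0 + D)))) (cR2W (KS.RK t O.merged 0 + D))) (hOf κ Φ t p O (KS.gT (KS.RK t O.merged 0 + D) (gxQ (KS.RK t O.merged 0 + D) (gxR0 (KS.RK t O.merged 0 + D)) (fxR (KS.RK t O.merged 0 + D)))) (KS.fT (KS.RK t O.merged 0 + D) (fxQ (KS.RK t O.merged 0 + D) (fxR (KS.RK t O.merged 0 + D)))) (hFR (KS.RK t O.merged 0 + D)))).r 1) ((KS.bwX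 κ Φ t p O.merged (KS.gT (KS.RK t O.merged 0 + D) (gxQ (KS.RK t O.merged 0 + D) (gxR0 (KS.RK t O.merged 0 + D)) (fxR (KS.RK t O.merged 0 + D))) κ Φ t p O.merged) (KS.fT (KS.RK t O.merged 0 + D) (fxQ (KS.RK t O.merged 0 + D) (fxR (KS.RK t O.merged 0 + D))) κ Φ t p O.merged)) : ℤ) ((KS.bwY κ Φ t p O.merged (KS.gT (KS.RK t O.merged 0 + D) (gxQ (KS.RK t O.merged 0 + D) (gxR0 (KS.RK t O.merged 0 + D)) (fxR (KS.RK t O.merged 0 + D))) κ Φ t p O.merged) (KS.fT (KS.RK t O.merged 0 + D) (fxQ (KS.RK t O.merged 0 + D) (fxR (KS.RK t O.merged 0 + D))) κ Φ t p O.merged)) : ℤ)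
    (KS.u₀A κ Φ t p O.merged (KS.gT (KS.RK t O.merged 0 + D) (gxQ (KS.RK t O.merged 0 + D) (gxR0 (KS.RK t O.merged 0 + D)) (fxR (KS.RK t O.merged 0 + D))) κ Φ t p O.merged) (KS.fT (KS.RK t O.merged 0 + D) (fxQ (KS.RK t O.merged 0 + D) (fxR (KS.RK t O.merged 0 + D))) κ Φ t p O.merged)) (KS.u₁A κ Φ t p O.merged (KS.gT (KS.RK t O.merged 0 + D) (gxQ (KS.RK t O.merged 0 + D) (gxR0 (KS.RK t O.merged 0 + D)) (fxR (KS.RK t O.merged 0 + D))) κ Φ t p O.merged) (KS.fT (KS.RK t O.merged 0 + D) (fxQ (KS.RK t O.merged 0 + D) (fxR (KS.RK t O.merged 0 + D))) κ Φ t p O.merged)) ((((KS0.Rlev0 κ Φ t p O.merged (KS.RK t O.merged 0 + D) + KS0.reach0 t O.merged (KS.RK t O.merged 0 + D)) - 1 : ℕ)) : ℤ) (KS0.R'0 κ Φ t p O.merged (KS.RK t O.merged 0 + D) : ℤ)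
    (by rw [hc0]; exact hhF0) (by rw [hc1]; exact hhF1) (by rw [hc0]; exact hcap0') (by rw [hc1]; exact hcap1') hbX hbY hr0' hr1' hR0 hu0 hu1 he
  obtain ⟨hcapX, hwinX, hcapY, hwinY, hwinYx⟩ := H

  -- the (F) column's layer (a7) under proxies at `(mk, mkP, cW) := (0, m′, cF κ)`, floors by the U slot lemmas at `m′` for every record
  have hLf : 840 * Neg.Kq κ + 10 ≤ LfQ κ.K₀ := by
    rw [LfQ_eq κ, Neg.K_eq]
    have h1 := Neg.one_le_Kq κ
    omega
  have hc600 : 600 * Neg.Kq κ ≤ cF κ := by have := (cF_eq κ).1; omega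
  exact faceOblRM_frmBVC₇Px 0 (KS.RK t O.merged 0 + D) (cF κ) (gxQ (KS.RK t O.merged 0 + D) (gxR0 (KS.RK t O.merged 0 + D)) (fxR (KS.RK t O.merged 0 + D))) (fxQ (KS.RK t O.merged 0 + D) (fxR (KS.RK t O.merged 0 + D)))
    (fun Dr => (le_gxQ (KS.RK t O.merged 0 + D) (gxR0 (KS.RK t O.merged 0 + D)) (fxR (KS.RK t O.merged 0 + D)) κ Φ t p Dr).2.1) (fun Dr => (le_fxQ (KS.RK t O.merged 0 + D) (fxR (KS.RK t O.merged 0 + D)) κ Φ t p Dr).2.1)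
    (exQ (KS.RK t O.merged 0 + D) (exRD (KS.RK t O.merged 0 + D) D)) (mxQ (mxF (KS.RK t O.merged 0 + D))) (fun Dr g f => exF2_le_exQ (KS.RK t O.merged 0 + D) (exRD (KS.RK t O.merged 0 + D) D) κ Φ t p Dr g f)
    (mF_le_mxF κ Φ t p O.merged _ _ (KS.RK t O.merged 0 + D)) hAtU hP hDk hnK hnL hnBF hRK hp0 hp1
    ((subset_PR_PxQ (KS.RK t O.merged 0 + D) κ Φ t p O.merged (PxR (KS.RK t O.merged 0 + D))).2.1 (Finset.mem_singleton_self _)) LfQ hCF hLf hc600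
    hcapX hwinX hcapY hwinY hwinYx

end NegB

end PlanarSkeletonFrmFrom

end Summit.CriticalPhenomena.PercolationContinuityZ3.Theorems.Transplant

end
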